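import Summits.CriticalPhenomena.PercolationContinuityZ3.Theorems.PercNearOneGluingNoHeavyLowerTailAntitheticTwoStageCone
import Summits.CriticalPhenomena.PercolationContinuityZ3.Theorems.PercNearOneGluingNoHeavyLowerTailAntitheticTwoStageMixed
import HarnessLib

/-!
# `NoHeavyLowerTail` (stmt-CriticalPhenomena-4575) — antithetic cluster pairs: CONDITIONAL POSITIVE ASSOCIATION given bicluster avoidance
# at one vertex adjacent to the source (HOME/MEMO-gen61.md §2, prim-hp-2 gen 61)

Support file (`--supports stmt-CriticalPhenomena-4575`, hull-port prover `prim-hp-2`, gen 61).  No definitions, no named facts, no sorries;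
standard axioms.  VERTEX version; notation of …AntitheticTwoStageCone: `X T = openCluster (T ∩ E) s`, `Y T = openCluster (Tᶜ ∩ E) s`.

CONJECTURE CPA (HOME/MEMO-gen61.md §2): for every edge set `E`, source `s` and `R`, the law of the pair `(X, Y)` on the bicluster-avoidance
event `D(R) = {T : ∀ r ∈ R, ¬(r ∈ X T ∧ r ∈ Y T)}` is positively associated for the twisted order — which contains the whole vertex
antithetic conjecture (odd test functions have mean zero on `D(R)`).  This file proves its first non-Harris instance:
* `Antithetic.CPA.single_of_R_associated` — if `sz ∈ E` and `(E, s, z)` is R-associated (hypothesis `hR` of `TwoStage.change_nonneg`,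
  i.e. the pair given `z ∉ Y` is positively associated), then for all twisted-monotone `f, g`
  `(Σ_{D({z})} f(X,Y)) (Σ_{D({z})} g(X,Y)) ≤ #D({z}) · Σ_{D({z})} f g (X,Y)`.
  Proof: `D({z}) = {z ∉ Y} ⊔ {z ∉ X}` (disjoint as `sz ∈ E`), the two halves are mirror images with positively associated laws (`hR` and its
  mirror), and they are stochastically ORDERED — `Σ_{z∉Y} (f − f∘swap) ≥ 0` by Harris on the whole cube (`f − f∘swap` is odd with total sum `0`
  and `{z ∉ Y}` is an up-set) — so the Chebyshev mixture step (`TwoStage.mix_two`) applies.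
* **`Antithetic.CPA.single_cone`** — for every rooted cone `s * H₂` (`E₂` on `{s} ∪ U₂` containing all spokes) and every `z ∈ U₂`:
  conditional positive association of `(X, Y)` given `¬(z ∈ X ∧ z ∈ Y)`, by THEOREM R (`TwoStage.Cone.R_associated`).
[cite: VandenbergHaggstromKahn2005, Thm. 1.3 (p. 6), §1 p. 6 ("Harris' inequality")]
-/

noncomputable section

namespace Summit.CriticalPhenomena.PercolationContinuityZ3.Theorems

open Literature.Probability.Percolation
open scoped Classical

namespace Antithetic

namespace CPA

variable {V : Type*} [Fintype V]

/-- **CPA at one vertex adjacent to the source, from R-association** (HOME/MEMO-gen61.md §2): if `sz ∈ E` and the pair `(X,Y)` given `z ∉ Y`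
is positively associated, then the pair given `¬(z ∈ X ∧ z ∈ Y)` is positively associated (twisted order). [this work] -/
theorem single_of_R_associated (E : Set (Sym2 V)) (s z : V) (hsz : s(s, z) ∈ E)
    (hR : ∀ Φ₁ Φ₂ : Set V → Set V → ℝ,
      (∀ ⦃A A' B B' : Set V⦄, A ⊆ A' → B' ⊆ B → Φ₁ A B ≤ Φ₁ A' B') → (∀ ⦃A A' B B' : Set V⦄, A ⊆ A' → B' ⊆ B → Φ₂ A B ≤ Φ₂ A' B') →
      (∑ T ∈ Finset.univ.filter (fun T : Set (Sym2 V) => z ∉ openCluster (Tᶜ ∩ E) s),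
          Φ₁ (openCluster (T ∩ E) s) (openCluster (Tᶜ ∩ E) s)) *
        (∑ T ∈ Finset.univ.filter (fun T : Set (Sym2 V) => z ∉ openCluster (Tᶜ ∩ E) s),
          Φ₂ (openCluster (T ∩ E) s) (openCluster (Tᶜ ∩ E) s)) ≤
      ((Finset.univ.filter fun T : Set (Sym2 V) => z ∉ openCluster (Tᶜ ∩ E) s).card : ℝ) *
        ∑ T ∈ Finset.univ.filter (fun T : Set (Sym2 V) => z ∉ openCluster (Tᶜ ∩ E) s),
          Φ₁ (openCluster (T ∩ E) s) (openCluster (Tᶜ ∩ E) s) * Φ₂ (openCluster (T ∩ E) s) (openCluster (Tᶜ ∩ E) s))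
    (f g : Set V → Set V → ℝ)
    (hf : ∀ ⦃A A' B B' : Set V⦄, A ⊆ A' → B' ⊆ B → f A B ≤ f A' B') (hg : ∀ ⦃A A' B B' : Set V⦄, A ⊆ A' → B' ⊆ B → g A B ≤ g A' B') :
    (∑ T ∈ Finset.univ.filter (fun T : Set (Sym2 V) => ¬ (z ∈ openCluster (T ∩ E) s ∧ z ∈ openCluster (Tᶜ ∩ E) s)),
        f (openCluster (T ∩ E) s) (openCluster (Tᶜ ∩ E) s)) *
      (∑ T ∈ Finset.univ.filter (fun T : Set (Sym2 V) => ¬ (z ∈ openCluster (T ∩ E) s ∧ z ∈ openCluster (Tᶜ ∩ E) s)),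
        g (openCluster (T ∩ E) s) (openCluster (Tᶜ ∩ E) s)) ≤
    ((Finset.univ.filter fun T : Set (Sym2 V) => ¬ (z ∈ openCluster (T ∩ E) s ∧ z ∈ openCluster (Tᶜ ∩ E) s)).card : ℝ) *
      ∑ T ∈ Finset.univ.filter (fun T : Set (Sym2 V) => ¬ (z ∈ openCluster (T ∩ E) s ∧ z ∈ openCluster (Tᶜ ∩ E) s)),
        f (openCluster (T ∩ E) s) (openCluster (Tᶜ ∩ E) s) * g (openCluster (T ∩ E) s) (openCluster (Tᶜ ∩ E) s) := by
  -- notation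
  let X : Set (Sym2 V) → Set V := fun T => openCluster (T ∩ E) s
  let Y : Set (Sym2 V) → Set V := fun T => openCluster (Tᶜ ∩ E) s
  have hXc : ∀ T, X Tᶜ = Y T := fun T => rfl
  have hYc : ∀ T, Y Tᶜ = X T := fun T => by show openCluster (Tᶜᶜ ∩ E) s = _; rw [compl_compl]
  -- `z ∈ X T ∨ z ∈ Y T` always (the edge `sz`)
  have hzXY : ∀ T, z ∈ X T ∨ z ∈ Y T := fun T => by
    by_cases hT : s(s, z) ∈ T
    · exact Or.inl (Freeze.mem_cluster_of_edge (mem_openCluster_self _ _) ⟨hT, hsz⟩)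
    · exact Or.inr (Freeze.mem_cluster_of_edge (mem_openCluster_self _ _) ⟨hT, hsz⟩)
  -- the two halves `A = {z ∉ Y}`, `B = {z ∉ X}` of `D({z})`
  have hsplit : ∀ F : Set (Sym2 V) → ℝ,
      ∑ T ∈ Finset.univ.filter (fun T : Set (Sym2 V) => ¬ (z ∈ X T ∧ z ∈ Y T)), F T =
        ∑ T ∈ Finset.univ.filter (fun T : Set (Sym2 V) => z ∉ Y T), F T + ∑ T ∈ Finset.univ.filter (fun T : Set (Sym2 V) => z ∉ X T), F T := by
    intro F
    rw [Finset.sum_filter, Finset.sum_filter, Finset.sum_filter, ← Finset.sum_add_distrib]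
    refine Finset.sum_congr rfl fun T _ => ?_
    by_cases hzY : z ∈ Y T
    · by_cases hzX : z ∈ X T
      · rw [if_neg (not_not.2 ⟨hzX, hzY⟩), if_neg (not_not.2 hzY), if_neg (not_not.2 hzX)]; ring
      · rw [if_pos (fun h => hzX h.1), if_neg (not_not.2 hzY), if_pos hzX]; ring
    · have hzX : z ∈ X T := (hzXY T).resolve_right hzY
      rw [if_pos (fun h => hzY h.2), if_pos hzY, if_neg (not_not.2 hzX)]; ring
  -- the mirror: sums over `B` are sums over `A` of the swapped function
  have hinv : ∀ F : Set (Sym2 V) → ℝ, ∑ T : Set (Sym2 V), F Tᶜ = ∑ T : Set (Sym2 V), F T := fun F =>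
    Fintype.sum_equiv (Function.Involutive.toPerm (compl : Set (Sym2 V) → Set (Sym2 V)) compl_involutive) (fun T => F Tᶜ) F (fun _ => rfl)
  have hmirror : ∀ F : Set V → Set V → ℝ,
      ∑ T ∈ Finset.univ.filter (fun T : Set (Sym2 V) => z ∉ X T), F (X T) (Y T) =
        ∑ T ∈ Finset.univ.filter (fun T : Set (Sym2 V) => z ∉ Y T), F (Y T) (X T) := by
    intro F
    rw [Finset.sum_filter, Finset.sum_filter, ← hinv (fun T => if z ∉ Y T then F (Y T) (X T) else 0)]
    refine Finset.sum_congr rfl fun T _ => ?_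
    show (if z ∉ X T then F (X T) (Y T) else 0) = (if z ∉ Y Tᶜ then F (Y Tᶜ) (X Tᶜ) else 0)
    rw [hYc, hXc]
  -- card of `D({z})` is twice the card `c` of `A`
  set A : Finset (Set (Sym2 V)) := Finset.univ.filter (fun T : Set (Sym2 V) => z ∉ Y T) with hAdef
  set c : ℝ := (A.card : ℝ) with hcdef
  have hcardA : c = ∑ T ∈ A, (1 : ℝ) := by rw [hcdef, Finset.sum_const, nsmul_eq_mul, mul_one]
  have hcardB : ∑ T ∈ Finset.univ.filter (fun T : Set (Sym2 V) => z ∉ X T), (1 : ℝ) = c := by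
    rw [hcardA]; exact hmirror (fun _ _ => (1 : ℝ))
  have hcardD : ((Finset.univ.filter fun T : Set (Sym2 V) => ¬ (z ∈ X T ∧ z ∈ Y T)).card : ℝ) = 2 * c := by
    have h1 : ((Finset.univ.filter fun T : Set (Sym2 V) => ¬ (z ∈ X T ∧ z ∈ Y T)).card : ℝ) =
        ∑ T ∈ Finset.univ.filter (fun T : Set (Sym2 V) => ¬ (z ∈ X T ∧ z ∈ Y T)), (1 : ℝ) := by
      rw [Finset.sum_const, nsmul_eq_mul, mul_one]
    rw [h1, hsplit (fun _ => (1 : ℝ)), hcardB, ← hcardA]; ring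
  -- the four partial sums
  set af : ℝ := ∑ T ∈ A, f (X T) (Y T) with haf
  set ag : ℝ := ∑ T ∈ A, g (X T) (Y T) with hag
  set bf : ℝ := ∑ T ∈ A, f (Y T) (X T) with hbf
  set bg : ℝ := ∑ T ∈ A, g (Y T) (X T) with hbg
  set afg : ℝ := ∑ T ∈ A, f (X T) (Y T) * g (X T) (Y T) with hafg
  set bfg : ℝ := ∑ T ∈ A, f (Y T) (X T) * g (Y T) (X T) with hbfg
  -- R-association on `A`, and on `B` via the mirror (applied to `-f∘swap`, `-g∘swap`)
  have hA : af * ag ≤ c * afg := hR f g hf hg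
  have hB : bf * bg ≤ c * bfg := by
    have h := hR (fun P Q => -f Q P) (fun P Q => -g Q P) (fun P P' Q Q' hP hQ => neg_le_neg (hf hQ hP))
      (fun P P' Q Q' hP hQ => neg_le_neg (hg hQ hP))
    have e1 : ∑ T ∈ A, -f (openCluster (Tᶜ ∩ E) s) (openCluster (T ∩ E) s) = -bf := by
      rw [hbf, ← Finset.sum_neg_distrib]
    have e2 : ∑ T ∈ A, -g (openCluster (Tᶜ ∩ E) s) (openCluster (T ∩ E) s) = -bg := by
      rw [hbg, ← Finset.sum_neg_distrib]
    have e3 : ∑ T ∈ A, -f (openCluster (Tᶜ ∩ E) s) (openCluster (T ∩ E) s) * -g (openCluster (Tᶜ ∩ E) s) (openCluster (T ∩ E) s) = bfg := by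
      rw [hbfg]; exact Finset.sum_congr rfl fun T _ => by ring
    rw [e1, e2, e3] at h
    linarith
  -- the halves are ordered: `bf ≤ af`, `bg ≤ ag` (Harris on the whole cube for the odd function `f − f∘swap`)
  have hord : ∀ F : Set V → Set V → ℝ, (∀ ⦃A A' B B' : Set V⦄, A ⊆ A' → B' ⊆ B → F A B ≤ F A' B') →
      ∑ T ∈ A, F (Y T) (X T) ≤ ∑ T ∈ A, F (X T) (Y T) := by
    intro F hF
    have hmono : Monotone (fun T : Set (Sym2 V) => F (X T) (Y T) - F (Y T) (X T)) := by
      intro T T' hTT'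
      have hXm : X T ⊆ X T' := Freeze.openCluster_mono (Set.inter_subset_inter_left E hTT') s
      have hYm : Y T' ⊆ Y T := Freeze.openCluster_mono (Set.inter_subset_inter_left E (Set.compl_subset_compl.2 hTT')) s
      exact sub_le_sub (hF hXm hYm) (hF hYm hXm)
    have hind : Monotone (fun T : Set (Sym2 V) => if z ∉ Y T then (1 : ℝ) else 0) := by
      intro T T' hTT'
      have hYm : Y T' ⊆ Y T := Freeze.openCluster_mono (Set.inter_subset_inter_left E (Set.compl_subset_compl.2 hTT')) s
      show (if z ∉ Y T then (1 : ℝ) else 0) ≤ (if z ∉ Y T' then (1 : ℝ) else 0)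
      by_cases h : z ∉ Y T
      · rw [if_pos h, if_pos (fun h' => h (hYm h'))]
      · rw [if_neg h]; split_ifs <;> norm_num
    have hH := TwoStage.harris_div hmono hind
    have hzero : ∑ T : Set (Sym2 V), (F (X T) (Y T) - F (Y T) (X T)) = 0 := by
      have h1 : ∑ T : Set (Sym2 V), (F (X T) (Y T) - F (Y T) (X T)) = ∑ T : Set (Sym2 V), (F (X Tᶜ) (Y Tᶜ) - F (Y Tᶜ) (X Tᶜ)) :=
        (hinv (fun T => F (X T) (Y T) - F (Y T) (X T))).symm
      have h2 : ∑ T : Set (Sym2 V), (F (X Tᶜ) (Y Tᶜ) - F (Y Tᶜ) (X Tᶜ)) = -∑ T : Set (Sym2 V), (F (X T) (Y T) - F (Y T) (X T)) := by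
        rw [← Finset.sum_neg_distrib]
        exact Finset.sum_congr rfl fun T _ => by rw [hXc, hYc]; ring
      linarith
    rw [hzero, zero_mul, zero_div] at hH
    have hre : ∑ T : Set (Sym2 V), (F (X T) (Y T) - F (Y T) (X T)) * (if z ∉ Y T then (1 : ℝ) else 0) =
        ∑ T ∈ A, (F (X T) (Y T) - F (Y T) (X T)) := by
      rw [hAdef, Finset.sum_filter]
      exact Finset.sum_congr rfl fun T _ => by split_ifs <;> simp
    rw [hre, Finset.sum_sub_distrib] at hH
    linarith
  have hof : bf ≤ af := hord f hf
  have hog : bg ≤ ag := hord g hg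
  -- assemble
  have hmix := TwoStage.mix_two hof hog
  rw [hsplit (fun T => f (X T) (Y T)), hsplit (fun T => g (X T) (Y T)), hsplit (fun T => f (X T) (Y T) * g (X T) (Y T)), hcardD,
    hmirror f, hmirror g, hmirror (fun P Q => f P Q * g P Q)]
  show (af + bf) * (ag + bg) ≤ 2 * c * (afg + bfg)
  nlinarith [hA, hB, hmix]

/-- **CPA at one vertex of a rooted cone** (HOME/MEMO-gen61.md §2): `E₂` any edge set on `{s} ∪ U₂` containing every spoke `sv`, `v ∈ U₂`
(a rooted cone `s * H₂`, `H₂` arbitrary), `z ∈ U₂`.  Then the law of `(X, Y)` given `¬(z ∈ X ∧ z ∈ Y)` is positively associated for the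
twisted order: the first instance of CONJECTURE CPA beyond Harris. [this work] -/
theorem single_cone (E₂ : Set (Sym2 V)) (s z : V) (U₂ : Set V) (hE₂ : ∀ e ∈ E₂, ∀ v ∈ e, v = s ∨ v ∈ U₂) (hz : z ∈ U₂)
    (hsp : ∀ v ∈ U₂, s(s, v) ∈ E₂) (f g : Set V → Set V → ℝ)
    (hf : ∀ ⦃A A' B B' : Set V⦄, A ⊆ A' → B' ⊆ B → f A B ≤ f A' B') (hg : ∀ ⦃A A' B B' : Set V⦄, A ⊆ A' → B' ⊆ B → g A B ≤ g A' B') :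
    (∑ T ∈ Finset.univ.filter (fun T : Set (Sym2 V) => ¬ (z ∈ openCluster (T ∩ E₂) s ∧ z ∈ openCluster (Tᶜ ∩ E₂) s)),
        f (openCluster (T ∩ E₂) s) (openCluster (Tᶜ ∩ E₂) s)) *
      (∑ T ∈ Finset.univ.filter (fun T : Set (Sym2 V) => ¬ (z ∈ openCluster (T ∩ E₂) s ∧ z ∈ openCluster (Tᶜ ∩ E₂) s)),
        g (openCluster (T ∩ E₂) s) (openCluster (Tᶜ ∩ E₂) s)) ≤
    ((Finset.univ.filter fun T : Set (Sym2 V) => ¬ (z ∈ openCluster (T ∩ E₂) s ∧ z ∈ openCluster (Tᶜ ∩ E₂) s)).card : ℝ) *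
      ∑ T ∈ Finset.univ.filter (fun T : Set (Sym2 V) => ¬ (z ∈ openCluster (T ∩ E₂) s ∧ z ∈ openCluster (Tᶜ ∩ E₂) s)),
        f (openCluster (T ∩ E₂) s) (openCluster (Tᶜ ∩ E₂) s) * g (openCluster (T ∩ E₂) s) (openCluster (Tᶜ ∩ E₂) s) :=
  single_of_R_associated E₂ s z (hsp z hz)
    (fun Φ₁ Φ₂ hΦ₁ hΦ₂ => TwoStage.Cone.R_associated E₂ s z (TwoStage.Cone.hcone_of_cone E₂ s z U₂ hE₂ hz hsp) Φ₁ Φ₂ hΦ₁ hΦ₂) f g hf hg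

end CPA

end Antithetic

end Summit.CriticalPhenomena.PercolationContinuityZ3.Theorems
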